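import Summits.CriticalPhenomena.PercolationContinuityZ3.Theorems.PercNearOneGluingNoHeavyQuantTwoBigChain
import HarnessLib

/-!
# QUANT lane R8, Conjecture DIB\* — the two-big certificate, cell `HH/C4`

builds on p205010 (kernel theorem, internal audit signed; external expert review pending)

Support file (`--supports stmt-CriticalPhenomena-4575`), QUANT lane census-1 (gen 17); memo
`run/shared/lean/prim/quant/prim-quant-census-1/TWOBIG-G17.md`.  Theorems only, no definitions, no sorries, standard axioms.
Coordinates `y = 1 − x`, `uᵢ = αᵢφᵢ`, `vᵢ = αᵢ(1 − φᵢ)` (`αᵢ = bᵢ/j`, `φᵢ` = credit rate of big `i`); the three `tbcBlock_*` lemmas are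
LP-found Handelman certificates (products of the cell's defining inequalities, replayed by `linarith`) of a separable budget split
`c₁ + c₂ + c₀ = (1−y)α₁α₂ − P₁P₂`, `cₖ·Dₖ ≤ Bₖ·Nₖ`; `tbcCell_*` combines them into the reduced inequality of the cell
(items in product form).  [this work]; the gluing rows served [cite: KozmaNitzan2024, Conjecture 3 (p. 15)].
-/

namespace Summit.CriticalPhenomena.PercolationContinuityZ3.Theorems

namespace Quant

namespace IndepBlob

set_option maxHeartbeats 1000000 in
set_option maxRecDepth 8192 in
/-- Two-big cell `HH/C4`, block 1: Handelman support (66 products; kit LP; split polynomial rounded to denominators ≤ 64). [this work] -/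
theorem tbcBlock_HH_C4_1 (y u₁ v₁ u₂ v₂ : ℝ) (_hy : 0 ≤ y) (_hhy : 0 ≤ 1 / 2 - y) (_hu1 : 0 ≤ u₁) (_hv1 : 0 ≤ v₁) (_hu2 : 0 ≤ u₂) (_hv2 : 0 ≤ v₂)
    (_ha1 : 0 ≤ 1 - u₁ - v₁) (_hb1 : 0 ≤ u₁ + v₁ - 1 / 2) (_ha2 : 0 ≤ 1 - u₂ - v₂) (_hb2 : 0 ≤ u₂ + v₂ - 1 / 2) (_ht1 : 0 ≤ u₁ * y - (1 - y) * v₁)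
    (_ht2 : 0 ≤ u₂ * y - (1 - y) * v₂) (_hr2 : 0 ≤ (2 - y) * (1 - u₂ - v₂) - (2 - u₁ - u₂)) :
    (3 / 64 * y - 7 / 32 * y * u₁ - 7 / 32 * y * u₂ + 7 / 64 * v₁ + 1 / 32 * y * v₁ + 11 / 64 * v₂ - 7 / 32 * y * v₂ + 43 / 64 * u₁ * v₂ + 5 / 64 * v₂
          ^ 2) * (y * (2 - u₁ - u₂) + (1 + v₁ - u₂) ^ 2)
      ≤ (u₁ * v₂) * (1 + v₁ - u₂) ^ 2 := by
  linarith [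
    mul_nonneg (mul_nonneg (mul_nonneg _hy _hy) _hy) _ha2, mul_nonneg (mul_nonneg (mul_nonneg _hy _hy) _hu1) _hv2,
    mul_nonneg (mul_nonneg (mul_nonneg _hy _hy) _hv1) _hu2, mul_nonneg (mul_nonneg (mul_nonneg _hy _hy) _hv1) _ha1,
    mul_nonneg (mul_nonneg (mul_nonneg _hy _hy) _hv1) _hb2, mul_nonneg (mul_nonneg _hy _hy) _hv2,
    mul_nonneg (mul_nonneg (mul_nonneg _hy _hy) _hv2) _ha2, mul_nonneg (mul_nonneg (mul_nonneg _hy _hy) _ha1) _ha2,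
    mul_nonneg (mul_nonneg (mul_nonneg _hy _hy) _ha2) _ha2, mul_nonneg (mul_nonneg _hy _hy) _hr2,
    mul_nonneg (mul_nonneg (mul_nonneg _hy _hhy) _hv1) _hv1, mul_nonneg (mul_nonneg (mul_nonneg _hy _hhy) _ha1) _ha1,
    mul_nonneg (mul_nonneg (mul_nonneg _hy _hv1) _hv1) _hv2, mul_nonneg (mul_nonneg (mul_nonneg _hy _hv1) _hv1) _ha1,
    mul_nonneg (mul_nonneg (mul_nonneg _hy _hv1) _hv1) _hb2, mul_nonneg (mul_nonneg (mul_nonneg _hy _hv1) _hv2) _hv2,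
    mul_nonneg (mul_nonneg (mul_nonneg _hy _hv1) _hv2) _ha1, mul_nonneg (mul_nonneg (mul_nonneg _hy _hv1) _hv2) _ha2,
    mul_nonneg (mul_nonneg (mul_nonneg _hy _hv1) _ha2) _hb2, mul_nonneg (mul_nonneg _hy _hv1) _ht1, mul_nonneg (mul_nonneg _hy _hv1) _hr2,
    mul_nonneg (mul_nonneg (mul_nonneg _hy _hu2) _hv2) _hv2, mul_nonneg (mul_nonneg (mul_nonneg _hy _hv2) _hv2) _ha1,
    mul_nonneg (mul_nonneg (mul_nonneg _hy _hv2) _ha1) _ha1, mul_nonneg (mul_nonneg (mul_nonneg _hy _hv2) _ha1) _ha2,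
    mul_nonneg (mul_nonneg (mul_nonneg _hy _hv2) _ha2) _hb2, mul_nonneg (mul_nonneg _hy _hv2) _ht2, mul_nonneg (mul_nonneg _hy _hv2) _hr2,
    mul_nonneg (mul_nonneg _hy _ha1) _ha1, mul_nonneg (mul_nonneg (mul_nonneg _hy _ha1) _ha2) _hb2, mul_nonneg (mul_nonneg _hy _ha1) _ht2,
    mul_nonneg (mul_nonneg _hy _ha1) _hr2, mul_nonneg (mul_nonneg (mul_nonneg _hy _ha2) _ha2) _hb2, mul_nonneg (mul_nonneg _hy _ha2) _ht1,
    mul_nonneg (mul_nonneg _hy _ha2) _ht2, mul_nonneg (mul_nonneg _hy _ha2) _hr2, mul_nonneg (mul_nonneg (mul_nonneg _hhy _hv1) _hv1) _hv1,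
    mul_nonneg (mul_nonneg (mul_nonneg _hhy _hv2) _hv2) _hv2, mul_nonneg (mul_nonneg (mul_nonneg _hu1 _hv1) _hv1) _hv2,
    mul_nonneg (mul_nonneg (mul_nonneg _hu1 _hv1) _hv2) _hv2, mul_nonneg (mul_nonneg (mul_nonneg _hu1 _hv2) _hv2) _hv2,
    mul_nonneg (mul_nonneg (mul_nonneg _hu1 _hv2) _hv2) _ha2, mul_nonneg (mul_nonneg (mul_nonneg _hv1 _hv1) _hu2) _hv2,
    mul_nonneg (mul_nonneg (mul_nonneg _hv1 _hv1) _hv2) _hb2, mul_nonneg (mul_nonneg _hv1 _hv1) _ht1, mul_nonneg (mul_nonneg _hv1 _hv1) _ht2,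
    mul_nonneg (mul_nonneg (mul_nonneg _hv1 _hu2) _hv2) _hv2, mul_nonneg (mul_nonneg (mul_nonneg _hv1 _hu2) _hv2) _ha1,
    mul_nonneg (mul_nonneg (mul_nonneg _hv1 _hv2) _hv2) _hb2, mul_nonneg (mul_nonneg (mul_nonneg _hv1 _hv2) _ha1) _hb2,
    mul_nonneg (mul_nonneg (mul_nonneg _hv1 _hv2) _ha2) _hb2, mul_nonneg (mul_nonneg _hv1 _hv2) _ht1, mul_nonneg (mul_nonneg _hv1 _hv2) _ht2,
    mul_nonneg (mul_nonneg _hv1 _hv2) _hr2, mul_nonneg (mul_nonneg _hv1 _ha1) _ht2, mul_nonneg (mul_nonneg _hv1 _ha2) _ht1,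
    mul_nonneg (mul_nonneg _hv1 _ha2) _ht2, mul_nonneg (mul_nonneg (mul_nonneg _hu2 _hv2) _hv2) _hv2,
    mul_nonneg (mul_nonneg (mul_nonneg _hu2 _hv2) _hv2) _ha1, mul_nonneg (mul_nonneg (mul_nonneg _hu2 _hv2) _hv2) _ha2,
    mul_nonneg (mul_nonneg (mul_nonneg _hv2 _hv2) _ha1) _hb2, mul_nonneg (mul_nonneg _hv2 _hv2) _hr2,
    mul_nonneg (mul_nonneg (mul_nonneg _hv2 _ha1) _ha2) _hb2, mul_nonneg (mul_nonneg _hv2 _ha2) _hr2, mul_nonneg (mul_nonneg _ha2 _ha2) _ht1,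
    mul_nonneg (mul_nonneg _ha2 _ha2) _ht2]

set_option maxHeartbeats 1000000 in
set_option maxRecDepth 8192 in
/-- Two-big cell `HH/C4`, block 2: Handelman support (43 products; kit LP; split polynomial rounded to denominators ≤ 64). [this work] -/
theorem tbcBlock_HH_C4_2 (y u₁ v₁ u₂ v₂ : ℝ) (_hy : 0 ≤ y) (_hhy : 0 ≤ 1 / 2 - y) (_hu1 : 0 ≤ u₁) (_hv1 : 0 ≤ v₁) (_hu2 : 0 ≤ u₂) (_hv2 : 0 ≤ v₂)
    (_ha1 : 0 ≤ 1 - u₁ - v₁) (_hb1 : 0 ≤ u₁ + v₁ - 1 / 2) (_ha2 : 0 ≤ 1 - u₂ - v₂) (_hb2 : 0 ≤ u₂ + v₂ - 1 / 2) (_ht1 : 0 ≤ u₁ * y - (1 - y) * v₁)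
    (_ht2 : 0 ≤ u₂ * y - (1 - y) * v₂) (_hr2 : 0 ≤ (2 - y) * (1 - u₂ - v₂) - (2 - u₁ - u₂)) :
    (9 / 64 * y - 9 / 32 * y * u₁ - 1 / 32 * y * u₂ + 13 / 64 * v₁ - 17 / 32 * y * v₁ + 23 / 64 * v₁ * u₂ - 5 / 64 * v₂ - 1 / 32 * y * v₂ + 9 / 64 *
          u₁ * v₂ + 11 / 64 * v₁ * v₂ - 5 / 64 * v₂ ^ 2) * ((2 - u₁ - u₂) - (1 - y) * (1 - u₂ - v₂))
      ≤ (v₁ * u₂) * ((1 - y) * (1 + v₂ - u₁)) := by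
  linarith [
    mul_nonneg (mul_nonneg (mul_nonneg _hy _hy) _hv1) _ha1, mul_nonneg (mul_nonneg (mul_nonneg _hy _hy) _hv1) _ha2,
    mul_nonneg (mul_nonneg (mul_nonneg _hy _hhy) _hv1) _hb2, mul_nonneg (mul_nonneg (mul_nonneg _hy _hhy) _ha1) _hb1,
    mul_nonneg (mul_nonneg (mul_nonneg _hy _hhy) _ha1) _hb2, mul_nonneg (mul_nonneg (mul_nonneg _hy _hv1) _hv1) _hv2,
    mul_nonneg (mul_nonneg (mul_nonneg _hy _hv1) _hu2) _hb2, mul_nonneg (mul_nonneg (mul_nonneg _hy _hv1) _hv2) _hv2,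
    mul_nonneg (mul_nonneg (mul_nonneg _hy _hv1) _hv2) _ha1, mul_nonneg (mul_nonneg (mul_nonneg _hy _hv1) _hb2) _hb2,
    mul_nonneg (mul_nonneg _hy _hv1) _ht1, mul_nonneg (mul_nonneg (mul_nonneg _hy _hv2) _hv2) _ha2,
    mul_nonneg (mul_nonneg (mul_nonneg _hy _hv2) _ha1) _ha1, mul_nonneg (mul_nonneg (mul_nonneg _hy _hv2) _ha1) _ha2,
    mul_nonneg (mul_nonneg (mul_nonneg _hy _ha1) _ha1) _hb2, mul_nonneg (mul_nonneg _hy _ha1) _hb2, mul_nonneg (mul_nonneg _hy _ha1) _ht1,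
    mul_nonneg (mul_nonneg _hy _ha1) _hr2, mul_nonneg (mul_nonneg _hy _ha2) _ht1, mul_nonneg (mul_nonneg _hy _ha2) _ht2,
    mul_nonneg (mul_nonneg (mul_nonneg _hhy _hv1) _hv1) _hu2, mul_nonneg (mul_nonneg (mul_nonneg _hhy _hv1) _hv1) _hb2,
    mul_nonneg (mul_nonneg (mul_nonneg _hhy _hv1) _hu2) _hv2, mul_nonneg (mul_nonneg (mul_nonneg _hhy _hv1) _hu2) _ha1,
    mul_nonneg (mul_nonneg (mul_nonneg _hhy _hv1) _hv2) _hb2, mul_nonneg (mul_nonneg (mul_nonneg _hhy _hv1) _ha1) _hb2,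
    mul_nonneg (mul_nonneg _hhy _hv1) _ht2, mul_nonneg (mul_nonneg _hv1 _hv1) _ht2, mul_nonneg (mul_nonneg _hv1 _hv2) _ht1,
    mul_nonneg (mul_nonneg _hv1 _hv2) _ht2, mul_nonneg (mul_nonneg _hv1 _hv2) _hr2, mul_nonneg (mul_nonneg _hv1 _ha1) _hb2,
    mul_nonneg (mul_nonneg _hv1 _hb1) _ht2, mul_nonneg (mul_nonneg _hv1 _ha2) _ht1, mul_nonneg _hv1 _ht1, mul_nonneg (mul_nonneg _hv2 _hv2) _hv2,
    mul_nonneg (mul_nonneg _hv2 _hv2) _ha1, mul_nonneg (mul_nonneg _hv2 _ha1) _ha1, mul_nonneg (mul_nonneg _hv2 _ha1) _ht1,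
    mul_nonneg (mul_nonneg _hv2 _hb1) _ht2, mul_nonneg _hv2 _ht1, mul_nonneg (mul_nonneg _ha1 _hb1) _ht2, mul_nonneg (mul_nonneg _ha1 _ha2) _ht1]

set_option maxHeartbeats 1000000 in
set_option maxRecDepth 8192 in
/-- Two-big cell `HH/C4`, block 0: Handelman support (7 products; kit LP; split polynomial rounded to denominators ≤ 64). [this work] -/
theorem tbcBlock_HH_C4_0 (y u₁ v₁ u₂ v₂ : ℝ) (_hy : 0 ≤ y) (_hhy : 0 ≤ 1 / 2 - y) (_hu1 : 0 ≤ u₁) (_hv1 : 0 ≤ v₁) (_hu2 : 0 ≤ u₂) (_hv2 : 0 ≤ v₂)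
    (_ha1 : 0 ≤ 1 - u₁ - v₁) (_hb1 : 0 ≤ u₁ + v₁ - 1 / 2) (_ha2 : 0 ≤ 1 - u₂ - v₂) (_hb2 : 0 ≤ u₂ + v₂ - 1 / 2) (_ht1 : 0 ≤ u₁ * y - (1 - y) * v₁)
    (_ht2 : 0 ≤ u₂ * y - (1 - y) * v₂) (_hr2 : 0 ≤ (2 - y) * (1 - u₂ - v₂) - (2 - u₁ - u₂)) :
    3 / 16 * u₁ * v₂ + 41 / 64 * v₁ * u₂ + 53 / 64 * v₁ * v₂ - y * u₁ * u₂ - y * u₁ * v₂ - y * v₁ * u₂ - y * v₁ * v₂ - 3 / 16 * y + 1 / 2 * y * u₁ + 1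
          / 4 * y * u₂ - 5 / 16 * v₁ + 1 / 2 * y * v₁ - 3 / 32 * v₂ + 1 / 4 * y * v₂ ≤ (0 : ℝ) := by
  linarith [
    mul_nonneg _hy _ha1, mul_nonneg (mul_nonneg _hy _ha1) _ha2, mul_nonneg (mul_nonneg _hy _hb1) _hb2, mul_nonneg _hb1 _ht2, mul_nonneg _hb2 _ht1,
    _ht1, _hy]

set_option maxHeartbeats 1000000 in
/-- **Two-big cell `HH/C4`**: the reduced inequality from the three blocks (items in product form `N ≤ t·D`). [this work] -/
theorem tbcCell_HH_C4 (y u₁ v₁ u₂ v₂ t₁ t₂ t₀ : ℝ) (hy0 : 0 < y) (hhy : y ≤ 1 / 2) (hu1 : 0 ≤ u₁) (hv1 : 0 ≤ v₁) (hu2 : 0 ≤ u₂) (hv2 : 0 ≤ v₂)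
    (ha1 : u₁ + v₁ ≤ 1) (hb1 : 1 / 2 ≤ u₁ + v₁) (ha2 : u₂ + v₂ ≤ 1) (hb2 : 1 / 2 ≤ u₂ + v₂) (ht1 : 0 ≤ u₁ * y - (1 - y) * v₁)
    (ht2 : 0 ≤ u₂ * y - (1 - y) * v₂) (hr2 : 0 ≤ (2 - y) * (1 - u₂ - v₂) - (2 - u₁ - u₂)) (hct : 0 < (2 - u₁ - u₂))
    (hT1 : (1 + v₁ - u₂) ^ 2 ≤ t₁ * (y * (2 - u₁ - u₂) + (1 + v₁ - u₂) ^ 2))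
    (hT2 : ((1 - y) * (1 + v₂ - u₁)) ≤ t₂ * ((2 - u₁ - u₂) - (1 - y) * (1 - u₂ - v₂))) (hT0 : 0 ≤ t₀) :
    (1 - y) * ((u₁ + v₁) * (u₂ + v₂))
      ≤ u₁ * u₂ + u₁ * v₂ * t₁ + v₁ * u₂ * t₂ + v₁ * v₂ * t₀ := by
  have b1 := tbcBlock_HH_C4_1 y u₁ v₁ u₂ v₂ hy0.le (by linarith) hu1 hv1 hu2 hv2 (by linarith) (by linarith) (by linarith) (by linarith) ht1 ht2 hr2
  have b2 := tbcBlock_HH_C4_2 y u₁ v₁ u₂ v₂ hy0.le (by linarith) hu1 hv1 hu2 hv2 (by linarith) (by linarith) (by linarith) (by linarith) ht1 ht2 hr2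
  have b0 := tbcBlock_HH_C4_0 y u₁ v₁ u₂ v₂ hy0.le (by linarith) hu1 hv1 hu2 hv2 (by linarith) (by linarith) (by linarith) (by linarith) ht1 ht2 hr2
  have hD1 : (0:ℝ) < (y * (2 - u₁ - u₂) + (1 + v₁ - u₂) ^ 2) := by
    have h1 := mul_pos hy0 hct
    have h2 := sq_nonneg (1 + v₁ - u₂)
    linarith
  have hD2 : (0:ℝ) < ((2 - u₁ - u₂) - (1 - y) * (1 - u₂ - v₂)) := by
    have h1 := mul_pos hy0 hct
    have h2 : (0:ℝ) ≤ (1 - y) * (1 + v₂ - u₁) := mul_nonneg (by linarith) (by linarith)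
    linarith
  have hP1 : (0:ℝ) ≤ u₁ := hu1
  have hQ1 : (0:ℝ) ≤ v₁ := hv1
  have hP2 : (0:ℝ) ≤ u₂ := hu2
  have hQ2 : (0:ℝ) ≤ v₂ := hv2
  have hBF1 : (0:ℝ) ≤ (u₁ * v₂) := mul_nonneg hP1 hQ2
  have k1 : (3 / 64 * y - 7 / 32 * y * u₁ - 7 / 32 * y * u₂ + 7 / 64 * v₁ + 1 / 32 * y * v₁ + 11 / 64 * v₂ - 7 / 32 * y * v₂ + 43 / 64 * u₁ * v₂ + 5 /
        64 * v₂ ^ 2) ≤ (u₁ * v₂) * t₁ := tbc_block_le _ _ _ _ _ hBF1 hD1 hT1 b1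
  have hBF2 : (0:ℝ) ≤ (v₁ * u₂) := mul_nonneg hQ1 hP2
  have k2 : (9 / 64 * y - 9 / 32 * y * u₁ - 1 / 32 * y * u₂ + 13 / 64 * v₁ - 17 / 32 * y * v₁ + 23 / 64 * v₁ * u₂ - 5 / 64 * v₂ - 1 / 32 * y * v₂ + 9
        / 64 * u₁ * v₂ + 11 / 64 * v₁ * v₂ - 5 / 64 * v₂ ^ 2) ≤ (v₁ * u₂) * t₂ := tbc_block_le _ _ _ _ _ hBF2 hD2 hT2 b2
  have hB0 : (0:ℝ) ≤ (v₁ * v₂) := mul_nonneg hQ1 hQ2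
  have k0 : (3 / 16 * u₁ * v₂ + 41 / 64 * v₁ * u₂ + 53 / 64 * v₁ * v₂ - y * u₁ * u₂ - y * u₁ * v₂ - y * v₁ * u₂ - y * v₁ * v₂ - 3 / 16 * y + 1 / 2 * y
        * u₁ + 1 / 4 * y * u₂ - 5 / 16 * v₁ + 1 / 2 * y * v₁ - 3 / 32 * v₂ + 1 / 4 * y * v₂) ≤ (v₁ * v₂) * t₀ := b0.trans (mul_nonneg hB0 hT0)
  have e : (3 / 64 * y - 7 / 32 * y * u₁ - 7 / 32 * y * u₂ + 7 / 64 * v₁ + 1 / 32 * y * v₁ + 11 / 64 * v₂ - 7 / 32 * y * v₂ + 43 / 64 * u₁ * v₂ + 5 /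
        64 * v₂ ^ 2) + (9 / 64 * y - 9 / 32 * y * u₁ - 1 / 32 * y * u₂ + 13 / 64 * v₁ - 17 / 32 * y * v₁ + 23 / 64 * v₁ * u₂ - 5 / 64 * v₂ - 1 / 32 *
        y * v₂ + 9 / 64 * u₁ * v₂ + 11 / 64 * v₁ * v₂ - 5 / 64 * v₂ ^ 2) + (3 / 16 * u₁ * v₂ + 41 / 64 * v₁ * u₂ + 53 / 64 * v₁ * v₂ - y * u₁ * u₂ - y
        * u₁ * v₂ - y * v₁ * u₂ - y * v₁ * v₂ - 3 / 16 * y + 1 / 2 * y * u₁ + 1 / 4 * y * u₂ - 5 / 16 * v₁ + 1 / 2 * y * v₁ - 3 / 32 * v₂ + 1 / 4 * y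
        * v₂) = (1 - y) * ((u₁ + v₁) * (u₂ + v₂)) - u₁ * u₂ := by ring
  have hsum := add_le_add (add_le_add k1 k2) k0
  calc (1 - y) * ((u₁ + v₁) * (u₂ + v₂)) = u₁ * u₂ + ((3 / 64 * y - 7 / 32 * y * u₁ - 7 / 32 * y * u₂ + 7 / 64 * v₁ + 1 / 32 * y * v₁ + 11 / 64 * v₂ -
        7 / 32 * y * v₂ + 43 / 64 * u₁ * v₂ + 5 / 64 * v₂ ^ 2) + (9 / 64 * y - 9 / 32 * y * u₁ - 1 / 32 * y * u₂ + 13 / 64 * v₁ - 17 / 32 * y * v₁ +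
        23 / 64 * v₁ * u₂ - 5 / 64 * v₂ - 1 / 32 * y * v₂ + 9 / 64 * u₁ * v₂ + 11 / 64 * v₁ * v₂ - 5 / 64 * v₂ ^ 2) + (3 / 16 * u₁ * v₂ + 41 / 64 * v₁
        * u₂ + 53 / 64 * v₁ * v₂ - y * u₁ * u₂ - y * u₁ * v₂ - y * v₁ * u₂ - y * v₁ * v₂ - 3 / 16 * y + 1 / 2 * y * u₁ + 1 / 4 * y * u₂ - 5 / 16 * v₁
        + 1 / 2 * y * v₁ - 3 / 32 * v₂ + 1 / 4 * y * v₂)) := by rw [e]; ring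
    _ ≤ u₁ * u₂ + (u₁ * v₂ * t₁ + v₁ * u₂ * t₂ + v₁ * v₂ * t₀) := add_le_add le_rfl hsum
    _ = _ := by ring

end IndepBlob

end Quant

end Summit.CriticalPhenomena.PercolationContinuityZ3.Theorems
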